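import Literature.Analysis.ODE.ConstCoeffL2Vanishing
import Mathlib.MeasureTheory.Function.JacobianOneDim
import Mathlib.Analysis.SpecialFunctions.ExpDeriv
import Mathlib.Analysis.SpecialFunctions.Log.Basic
import HarnessLib

/-!
# Square-integrable solutions of Euler (equidimensional) equations on `(0, ∞)` vanish

Topic `Literature/Analysis/ODE`. Proof file (everything proved; no definitions, no named facts),
companion of `ConstCoeffL2Vanishing.lean`: a classical solution `d ∈ C²((0,∞))` of the Euler
equation `α²R²d″ + βRd′ + γd = 0` (`α ≠ 0`) with `∫₀^∞ d² dR < ∞` vanishes identically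
(`eq_zero_of_euler_of_integrableOn_sq`). Proof: `v(s) = e^{s/2} d(e^s)` is an `L²(ℝ)` solution of
a constant-coefficient equation (`R = e^s` turns `R∂_R` into `∂_s`, and `dR = e^s ds`), hence
vanishes by `eq_zero_of_ode_of_integrable_sq`. Written for the radial modes of finite-energy very
weak solutions of Elgindi's polar elliptic problem (`Literature/Analysis/FluidPDE/Elgindi*`).

## References

* E. A. Coddington, N. Levinson, *Theory of Ordinary Differential Equations*, McGraw–Hill 1955,
  Ch. 4 §1 (Euler's equation). [folklore]
-/

noncomputable section

open MeasureTheory Set Real Filter Function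
open _root_.Topology

namespace Literature.Analysis.ODE

/-- **Change of variables `R = e^s`**: `∫₀^∞ g = ∫_ℝ e^s g(e^s) ds` at the level of integrability. [folklore] -/
theorem integrable_exp_mul_comp_exp_iff (g : ℝ → ℝ) :
    Integrable (fun s => Real.exp s * g (Real.exp s)) ↔ IntegrableOn g (Ioi 0) := by
  have h := integrableOn_image_iff_integrableOn_abs_deriv_smul (s := univ) (f := Real.exp) (f' := Real.exp) MeasurableSet.univ
    (fun x _ => (Real.hasDerivAt_exp x).hasDerivWithinAt) Real.exp_injective.injOn g
  rw [image_univ, Real.range_exp, integrableOn_univ] at h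
  rw [h]
  refine integrable_congr (ae_of_all _ fun s => ?_)
  simp [abs_of_pos (Real.exp_pos s)]

/-- **An `L²((0,∞))` solution of the Euler equation `α²R²d″ + βRd′ + γd = 0` (`α ≠ 0`) vanishes.** [folklore] -/
theorem eq_zero_of_euler_of_integrableOn_sq {d : ℝ → ℝ} (hd : ContDiffOn ℝ 2 d (Ioi 0)) {α β γ : ℝ} (hα : α ≠ 0)
    (hode : ∀ R, 0 < R → α ^ 2 * R ^ 2 * deriv (deriv d) R + β * R * deriv d R + γ * d R = 0)
    (hL2 : IntegrableOn (fun R => d R ^ 2) (Ioi 0)) : ∀ R, 0 < R → d R = 0 := by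
  -- regularity of `d` on the open half-line
  have hd1 : ContDiffOn ℝ 1 (deriv d) (Ioi 0) := hd.deriv_of_isOpen (m := 1) isOpen_Ioi (by norm_num)
  have hdd : ∀ R, 0 < R → HasDerivAt d (deriv d R) R := fun R hR =>
    ((hd.differentiableOn (by norm_num)).differentiableAt (Ioi_mem_nhds hR)).hasDerivAt
  have hdd' : ∀ R, 0 < R → HasDerivAt (deriv d) (deriv (deriv d) R) R := fun R hR =>
    ((hd1.differentiableOn (by norm_num)).differentiableAt (Ioi_mem_nhds hR)).hasDerivAt
  -- `D(s) = d(e^s)` and `v(s) = e^{s/2} D(s)`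
  set D : ℝ → ℝ := fun s => d (Real.exp s) with hD
  set v : ℝ → ℝ := fun s => Real.exp (s / 2) * D s with hv
  have hDc : ContDiff ℝ 2 D := hd.comp_contDiff Real.contDiff_exp fun s => Real.exp_pos s
  have hvc : ContDiff ℝ 2 v := by
    refine ContDiff.mul ?_ hDc
    exact Real.contDiff_exp.comp (contDiff_id.div_const 2)
  -- first derivatives
  have hD' : ∀ s, HasDerivAt D (Real.exp s * deriv d (Real.exp s)) s := fun s => by
    have := (hdd _ (Real.exp_pos s)).comp s (Real.hasDerivAt_exp s)
    refine this.congr_deriv ?_; ring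
  have eD' : deriv D = fun s => Real.exp s * deriv d (Real.exp s) := funext fun s => (hD' s).deriv
  have hD'' : ∀ s, HasDerivAt (deriv D) (Real.exp s * deriv d (Real.exp s) + Real.exp s * (Real.exp s * deriv (deriv d) (Real.exp s))) s :=
    fun s => by
    rw [eD']
    have h2 := (hdd' _ (Real.exp_pos s)).comp s (Real.hasDerivAt_exp s)
    have := (Real.hasDerivAt_exp s).mul h2
    refine this.congr_deriv ?_
    simp only [Function.comp]; ring
  have eD'' : ∀ s, deriv (deriv D) s = Real.exp s * deriv d (Real.exp s) + Real.exp s ^ 2 * deriv (deriv d) (Real.exp s) :=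
    fun s => by rw [(hD'' s).deriv]; ring
  have hE : ∀ s, HasDerivAt (fun s => Real.exp (s / 2)) (Real.exp (s / 2) / 2) s := fun s => by
    have := (Real.hasDerivAt_exp (s / 2)).comp s ((hasDerivAt_id s).div_const 2)
    refine this.congr_deriv ?_; simp; ring
  have hv' : ∀ s, HasDerivAt v (Real.exp (s / 2) / 2 * D s + Real.exp (s / 2) * (Real.exp s * deriv d (Real.exp s))) s :=
    fun s => (hE s).mul (hD' s)
  have ev' : deriv v = fun s => Real.exp (s / 2) / 2 * D s + Real.exp (s / 2) * (Real.exp s * deriv d (Real.exp s)) :=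
    funext fun s => (hv' s).deriv
  have hv'' : ∀ s, HasDerivAt (deriv v)
      (Real.exp (s / 2) / 2 / 2 * D s + Real.exp (s / 2) / 2 * (Real.exp s * deriv d (Real.exp s)) +
        (Real.exp (s / 2) / 2 * (Real.exp s * deriv d (Real.exp s)) +
          Real.exp (s / 2) * (Real.exp s * deriv d (Real.exp s) + Real.exp s * (Real.exp s * deriv (deriv d) (Real.exp s))))) s := by
    intro s
    rw [ev']
    have h1 := ((hE s).div_const 2).mul (hD' s)
    have h2 := (hE s).mul (by rw [← eD']; exact hD'' s : HasDerivAt (fun s => Real.exp s * deriv d (Real.exp s)) _ s)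
    have := h1.add h2
    refine this.congr_deriv ?_
    ring
  have ev'' : ∀ s, deriv (deriv v) s =
      Real.exp (s / 2) * (D s / 4 + 2 * (Real.exp s * deriv d (Real.exp s)) + Real.exp s ^ 2 * deriv (deriv d) (Real.exp s)) :=
    fun s => by rw [(hv'' s).deriv]; ring
  -- the constant-coefficient equation for `v`
  have hodev : ∀ s, α ^ 2 * deriv (deriv v) s + (β - 2 * α ^ 2) * deriv v s + (α ^ 2 / 4 - (β - α ^ 2) / 2 + γ) * v s = 0 := by
    intro s
    rw [ev'', ev']
    have h := hode (Real.exp s) (Real.exp_pos s)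
    simp only [hv, hD]
    have hexp : Real.exp s ^ 2 = Real.exp s * Real.exp s := sq _
    -- everything is `e^{s/2}` times a combination of the Euler equation
    have : α ^ 2 * (Real.exp (s / 2) * (d (Real.exp s) / 4 + 2 * (Real.exp s * deriv d (Real.exp s)) + Real.exp s ^ 2 * deriv (deriv d) (Real.exp s))) +
        (β - 2 * α ^ 2) * (Real.exp (s / 2) / 2 * d (Real.exp s) + Real.exp (s / 2) * (Real.exp s * deriv d (Real.exp s))) +
        (α ^ 2 / 4 - (β - α ^ 2) / 2 + γ) * (Real.exp (s / 2) * d (Real.exp s)) =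
        Real.exp (s / 2) * (α ^ 2 * Real.exp s ^ 2 * deriv (deriv d) (Real.exp s) + β * Real.exp s * deriv d (Real.exp s) + γ * d (Real.exp s)) := by
      ring
    rw [this, h, mul_zero]
  -- `v ∈ L²(ℝ)`
  have hv2 : Integrable fun s => v s ^ 2 := by
    have h := (integrable_exp_mul_comp_exp_iff (fun R => d R ^ 2)).2 hL2
    refine h.congr (ae_of_all _ fun s => ?_)
    show Real.exp s * d (Real.exp s) ^ 2 = (Real.exp (s / 2) * d (Real.exp s)) ^ 2
    rw [mul_pow, sq (Real.exp (s / 2)), ← Real.exp_add, show s / 2 + s / 2 = s by ring]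
  have hzero := eq_zero_of_ode_of_integrable_sq hvc (pow_ne_zero 2 hα) hodev hv2
  intro R hR
  have h := hzero (Real.log R)
  simp only [hv, hD, Real.exp_log hR] at h
  rcases mul_eq_zero.1 h with h | h
  · exact absurd h (Real.exp_pos _).ne'
  · exact h

end Literature.Analysis.ODE
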